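import Summits.AtomisticToContinuum.Crystallization.Theorems.ChartedZeroExcessLayeredLatticeLiouvilleZZZYRCF
import Summits.AtomisticToContinuum.Crystallization.Theorems.ChartedZeroExcessLayeredLatticeLiouvilleZZZYRCG

/-!
# Charted zero-excess layered-lattice Liouville — ZZZYRCHA: path data, scheme coefficients and the termwise far bound (line (D), part a)

Cell `decomp-a2c`, lens 2, generation 99.  SPLIT EDITION of the generic tail theorem (critic r1806: per-file metric ≤ 399 l; split pre-licensed
under (291)(292), same decl names, no statement change).  PART A (this file): the PATH DATA interface `piece`, `IsPathSystem ϱ a b w np z`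
(for every FAR pair `ϱ < ‖e_x‖` the nodes `z x 0 = x.1, …, z x (np x) = x.2` with pieces of length in `(0, ϱ]`; INHABITED for every
co-Lipschitz word and every `ϱ` at least the longest index-unit step — e.g. the straight index-split path — so `BoxSchemeP` is never vacuous),
the scheme coefficients `cosSq`, `schemeCoefR = (1+α)·n·cos²·a₋(‖e_x‖)`, `schemeCoefN = (1+α⁻¹)·n·sin²·a₋(‖e_x‖)` (exactly the coefficients of
`indexSplit_bound`, ZZZYRCF), the termwise `schemeMajorant`, the partial-sum TABLE DOMINATION `SchemeDominatedP ϱ α a b w np z ΘR ΘN` and its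
box form `BoxSchemeP`; the elementary lemmas; local finiteness of near pairs `finite_nearPairs` (from the tree's `finite_near_lsite`); the finite
regrouping inequality `regroup_le`; and (TL-1)+(TL-IS) the termwise far bound `far_pair_lower : −schemeMajorant x ≤ pairHess x`
(`pairHess_radial_lower` + `indexSplit_bound` + telescoping along the path).  PART B (ZZZYRCH): (FUB) + (TL-2) + `boxTailDebitP_of_scheme`.

Def + theorem file (8 defs, 13 theorems); imports ZZZYRCF, ZZZYRCG (tree); no instance / notation / option; 0 sorry. [g99]
-/

open scoped BigOperators InnerProductSpace RealInnerProductSpace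

namespace Summit.AtomisticToContinuum.Crystallization.Theorems.ChartedZeroExcessLayeredLatticeLiouville

open Summit.AtomisticToContinuum.Crystallization.Theorems.ChartedPlanarOrderRigidityDoor (E3)

/-! ### Path data and the scheme coefficients -/

/-- piece `i` of the path of the ordered pair `x`: `(z x i, z x (i+1))`. [g99] -/
def piece (z : (Cell 2 × ℤ) × (Cell 2 × ℤ) → ℕ → Cell 2 × ℤ) (x : (Cell 2 × ℤ) × (Cell 2 × ℤ)) (i : ℕ) :
    (Cell 2 × ℤ) × (Cell 2 × ℤ) :=
  (z x i, z x (i + 1))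

/-- **PATH SYSTEM**: for every FAR ordered pair `x` (`ϱ < ‖e_x‖`) the nodes `z x 0 … z x (np x)` run from `x.1` to `x.2` and every piece has
length in `(0, ϱ]` (so it is a pair of the range form). Nothing is asked of non-far pairs. [g99] -/
def IsPathSystem (ϱ : ℝ) (a b : E3) (w : ℤ → E3) (np : (Cell 2 × ℤ) × (Cell 2 × ℤ) → ℕ)
    (z : (Cell 2 × ℤ) × (Cell 2 × ℤ) → ℕ → Cell 2 × ℤ) : Prop :=
  ∀ x : (Cell 2 × ℤ) × (Cell 2 × ℤ), ϱ < ‖bondVec a b w x‖ →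
    z x 0 = x.1 ∧ z x (np x) = x.2 ∧ ∀ i < np x, 0 < ‖bondVec a b w (piece z x i)‖ ∧ ‖bondVec a b w (piece z x i)‖ ≤ ϱ

/-- `cos²` of the angle between the far bond `e_x` and its piece `i` (junk `0` on degenerate data). [g99] -/
noncomputable def cosSq (a b : E3) (w : ℤ → E3) (z : (Cell 2 × ℤ) × (Cell 2 × ℤ) → ℕ → Cell 2 × ℤ)
    (x : (Cell 2 × ℤ) × (Cell 2 × ℤ)) (i : ℕ) : ℝ :=
  ⟪bondVec a b w x, bondVec a b w (piece z x i)⟫ ^ 2 / (‖bondVec a b w x‖ ^ 2 * ‖bondVec a b w (piece z x i)‖ ^ 2)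

/-- STRETCH increment of piece `i` of `x`: `(1+α)·n·cos²θᵢ·a₋(‖e_x‖)` (the first coefficient of `indexSplit_bound`). [g99] -/
noncomputable def schemeCoefR (α : ℝ) (a b : E3) (w : ℤ → E3) (np : (Cell 2 × ℤ) × (Cell 2 × ℤ) → ℕ)
    (z : (Cell 2 × ℤ) × (Cell 2 × ℤ) → ℕ → Cell 2 × ℤ) (x : (Cell 2 × ℤ) × (Cell 2 × ℤ)) (i : ℕ) : ℝ :=
  (1 + α) * (np x : ℝ) * cosSq a b w z x i * aMinus ‖bondVec a b w x‖

/-- NORM increment of piece `i` of `x`: `(1+α⁻¹)·n·sin²θᵢ·a₋(‖e_x‖)` (the second coefficient of `indexSplit_bound`). [g99] -/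
noncomputable def schemeCoefN (α : ℝ) (a b : E3) (w : ℤ → E3) (np : (Cell 2 × ℤ) × (Cell 2 × ℤ) → ℕ)
    (z : (Cell 2 × ℤ) × (Cell 2 × ℤ) → ℕ → Cell 2 × ℤ) (x : (Cell 2 × ℤ) × (Cell 2 × ℤ)) (i : ℕ) : ℝ :=
  (1 + α⁻¹) * (np x : ℝ) * (1 - cosSq a b w z x i) * aMinus ‖bondVec a b w x‖

/-- THE SCHEME MAJORANT of the far pair `x` under `φ`: `Σᵢ (cRᵢ·sqStretch(pieceᵢ) + cNᵢ·‖Δφ(pieceᵢ)‖²)`. [g99] -/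
noncomputable def schemeMajorant (α : ℝ) (a b : E3) (w : ℤ → E3) (np : (Cell 2 × ℤ) × (Cell 2 × ℤ) → ℕ)
    (z : (Cell 2 × ℤ) × (Cell 2 × ℤ) → ℕ → Cell 2 × ℤ) (φ : Cell 2 → ℤ → E3) (x : (Cell 2 × ℤ) × (Cell 2 × ℤ)) : ℝ :=
  ∑ i ∈ Finset.range (np x), (schemeCoefR α a b w np z x i * sqStretch a b w φ (piece z x i) +
    schemeCoefN α a b w np z x i * ‖φ (z x (i + 1)).1 (z x (i + 1)).2 - φ (z x i).1 (z x i).2‖ ^ 2)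

/-- **TABLE DOMINATION (partial-sum form)**: for every finite set `X` of far pairs and every pair `y`, the stretch (resp. norm) increments of
the pieces equal to `y` sum to at most `ΘR y` (resp. `ΘN y`). This is what the JS-D K-file proves for its box tables (enumeration to `DFAR` + the
per-class remainder, memo NODE-g99 §2(c)(f′)). [g99] -/
def SchemeDominatedP (ϱ α : ℝ) (a b : E3) (w : ℤ → E3) (np : (Cell 2 × ℤ) × (Cell 2 × ℤ) → ℕ)
    (z : (Cell 2 × ℤ) × (Cell 2 × ℤ) → ℕ → Cell 2 × ℤ) (ΘR ΘN : (Cell 2 × ℤ) × (Cell 2 × ℤ) → ℝ) : Prop :=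
  ∀ X : Finset ((Cell 2 × ℤ) × (Cell 2 × ℤ)), (∀ x ∈ X, ϱ < ‖bondVec a b w x‖) → ∀ y : (Cell 2 × ℤ) × (Cell 2 × ℤ),
    (∑ x ∈ X, ∑ i ∈ Finset.range (np x), if piece z x i = y then schemeCoefR α a b w np z x i else 0) ≤ ΘR y ∧
      (∑ x ∈ X, ∑ i ∈ Finset.range (np x), if piece z x i = y then schemeCoefN α a b w np z x i else 0) ≤ ΘN y

/-- **BOX SCHEME «BoxSchemeP s Λ c₀ ℓ₀ ϱ α B np z ΘR ΘN»**: on the admissible words of box `B` the (word-indexed) path data form a path system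
and the box tables dominate the scheme — the JS-D K-file's tail obligation. [g99] -/
def BoxSchemeP (s Λ c₀ ℓ₀ ϱ α : ℝ) (B : (E3 ≃L[ℝ] E3) → (ℤ → E3) → Prop)
    (np : (E3 ≃L[ℝ] E3) → (ℤ → E3) → (Cell 2 × ℤ) × (Cell 2 × ℤ) → ℕ)
    (z : (E3 ≃L[ℝ] E3) → (ℤ → E3) → (Cell 2 × ℤ) × (Cell 2 × ℤ) → ℕ → Cell 2 × ℤ)
    (ΘR ΘN : (E3 ≃L[ℝ] E3) → (ℤ → E3) → (Cell 2 × ℤ) × (Cell 2 × ℤ) → ℝ) : Prop :=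
  ∀ a : ℝ, 0 < a → ∀ (L : E3 ≃L[ℝ] E3) (w' : ℤ → E3), IsAdmissibleWord a s Λ c₀ ℓ₀ L w' → B L w' →
    IsPathSystem ϱ (gen₁ L) (gen₂ L) w' (np L w') (z L w') ∧
      SchemeDominatedP ϱ α (gen₁ L) (gen₂ L) w' (np L w') (z L w') (ΘR L w') (ΘN L w')

/-! ### Elementary lemmas -/

/-- `⟪e/‖e‖, v⟫² = ⟪e, v⟫² / ‖e‖²` for `e ≠ 0`. [g99] -/
theorem inner_unit_sq (e v : E3) (he : e ≠ 0) : ⟪‖e‖⁻¹ • e, v⟫ ^ 2 = ⟪e, v⟫ ^ 2 / ‖e‖ ^ 2 := by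
  have hn : ‖e‖ ≠ 0 := norm_ne_zero_iff.mpr he
  rw [real_inner_smul_left]
  field_simp

/-- Telescoping of `φ` along the nodes of a path: `φ(z n) − φ(z 0) = Σ_{i<n} (φ(z (i+1)) − φ(z i))`. [g99] -/
theorem telescope_pieces (φ : Cell 2 → ℤ → E3) (z : ℕ → Cell 2 × ℤ) (n : ℕ) :
    ∑ i ∈ Finset.range n, (φ (z (i + 1)).1 (z (i + 1)).2 - φ (z i).1 (z i).2) = φ (z n).1 (z n).2 - φ (z 0).1 (z 0).2 :=
  Finset.sum_range_sub (fun i => φ (z i).1 (z i).2) n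

/-- `0 ≤ cosSq`. [g99] -/
theorem cosSq_nonneg (a b : E3) (w : ℤ → E3) (z : (Cell 2 × ℤ) × (Cell 2 × ℤ) → ℕ → Cell 2 × ℤ)
    (x : (Cell 2 × ℤ) × (Cell 2 × ℤ)) (i : ℕ) : 0 ≤ cosSq a b w z x i :=
  div_nonneg (sq_nonneg _) (mul_nonneg (sq_nonneg _) (sq_nonneg _))

/-- `cosSq ≤ 1` (Cauchy–Schwarz for the two unit vectors). [g99] -/
theorem cosSq_le_one (a b : E3) (w : ℤ → E3) (z : (Cell 2 × ℤ) × (Cell 2 × ℤ) → ℕ → Cell 2 × ℤ)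
    (x : (Cell 2 × ℤ) × (Cell 2 × ℤ)) (i : ℕ) : cosSq a b w z x i ≤ 1 := by
  unfold cosSq
  refine div_le_one_of_le₀ ?_ (mul_nonneg (sq_nonneg _) (sq_nonneg _))
  have h := abs_real_inner_le_norm (bondVec a b w x) (bondVec a b w (piece z x i))
  have h0 : 0 ≤ |⟪bondVec a b w x, bondVec a b w (piece z x i)⟫| := abs_nonneg _
  calc ⟪bondVec a b w x, bondVec a b w (piece z x i)⟫ ^ 2 = |⟪bondVec a b w x, bondVec a b w (piece z x i)⟫| ^ 2 := (sq_abs _).symm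
    _ ≤ (‖bondVec a b w x‖ * ‖bondVec a b w (piece z x i)‖) ^ 2 := pow_le_pow_left₀ h0 h 2
    _ = ‖bondVec a b w x‖ ^ 2 * ‖bondVec a b w (piece z x i)‖ ^ 2 := by ring

/-- The stretch coefficient of the scheme is non-negative (`α > 0`, `a₋ ≥ 0`). [g99] -/
theorem schemeCoefR_nonneg {α : ℝ} (hα : 0 < α) (a b : E3) (w : ℤ → E3) (np : (Cell 2 × ℤ) × (Cell 2 × ℤ) → ℕ)
    (z : (Cell 2 × ℤ) × (Cell 2 × ℤ) → ℕ → Cell 2 × ℤ) (x : (Cell 2 × ℤ) × (Cell 2 × ℤ)) (i : ℕ) :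
    0 ≤ schemeCoefR α a b w np z x i :=
  mul_nonneg (mul_nonneg (mul_nonneg (by linarith) (Nat.cast_nonneg _)) (cosSq_nonneg a b w z x i)) (aMinus_nonneg _)

/-- The norm coefficient of the scheme is non-negative (`α > 0`, `cosSq ≤ 1`, `a₋ ≥ 0`). [g99] -/
theorem schemeCoefN_nonneg {α : ℝ} (hα : 0 < α) (a b : E3) (w : ℤ → E3) (np : (Cell 2 × ℤ) × (Cell 2 × ℤ) → ℕ)
    (z : (Cell 2 × ℤ) × (Cell 2 × ℤ) → ℕ → Cell 2 × ℤ) (x : (Cell 2 × ℤ) × (Cell 2 × ℤ)) (i : ℕ) :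
    0 ≤ schemeCoefN α a b w np z x i := by
  have h1 : 0 ≤ 1 + α⁻¹ := by positivity
  have h2 : 0 ≤ 1 - cosSq a b w z x i := sub_nonneg.mpr (cosSq_le_one a b w z x i)
  exact mul_nonneg (mul_nonneg (mul_nonneg h1 (Nat.cast_nonneg _)) h2) (aMinus_nonneg _)

/-- `0 ≤ sqStretch` (a square). [g99] -/
theorem sqStretch_nonneg (a b : E3) (w : ℤ → E3) (φ : Cell 2 → ℤ → E3) (x : (Cell 2 × ℤ) × (Cell 2 × ℤ)) :
    0 ≤ sqStretch a b w φ x :=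
  div_nonneg (sq_nonneg _) (sq_nonneg _)

/-- The scheme majorant of a pair is non-negative. [g99] -/
theorem schemeMajorant_nonneg {α : ℝ} (hα : 0 < α) (a b : E3) (w : ℤ → E3) (np : (Cell 2 × ℤ) × (Cell 2 × ℤ) → ℕ)
    (z : (Cell 2 × ℤ) × (Cell 2 × ℤ) → ℕ → Cell 2 × ℤ) (φ : Cell 2 → ℤ → E3) (x : (Cell 2 × ℤ) × (Cell 2 × ℤ)) :
    0 ≤ schemeMajorant α a b w np z φ x :=
  Finset.sum_nonneg fun i _ => add_nonneg (mul_nonneg (schemeCoefR_nonneg hα a b w np z x i) (sqStretch_nonneg a b w φ _))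
    (mul_nonneg (schemeCoefN_nonneg hα a b w np z x i) (sq_nonneg _))

/-- the pair summand read through the force constant of the bond (off the diagonal). [g99] -/
theorem pairHess_eq_forceConst (a b : E3) (w : ℤ → E3) (φ : Cell 2 → ℤ → E3) (x : (Cell 2 × ℤ) × (Cell 2 × ℤ)) (hx : x.2 ≠ x.1) :
    pairHess a b w φ x = ⟪φ x.2.1 x.2.2 - φ x.1.1 x.1.2, forceConst (bondVec a b w x) (φ x.2.1 x.2.2 - φ x.1.1 x.1.2)⟫ := by
  unfold pairHess
  rw [layeredKernel_sub_fst_eq a b w x.1 x.2, if_neg hx]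
  rfl

/-- test-field differences vanish off the support. [g99] -/
theorem diff_eq_zero_of_notMem {φ : Cell 2 → ℤ → E3} {S : Finset (Cell 2 × ℤ)} (hS : ∀ γ m, (γ, m) ∉ S → φ γ m = 0)
    (x : (Cell 2 × ℤ) × (Cell 2 × ℤ)) (h1 : x.1 ∉ S) (h2 : x.2 ∉ S) : φ x.2.1 x.2.2 - φ x.1.1 x.1.2 = 0 := by
  rw [hS x.2.1 x.2.2 h2, hS x.1.1 x.1.2 h1, sub_zero]

/-- LOCAL FINITENESS: the pairs of length `≤ ϱ` touching a finite index set form a finite set (co-Lipschitz word, tree `finite_near_lsite`). [g99] -/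
theorem finite_nearPairs {c : ℝ} (hc : 0 < c) {a b : E3} {w : ℤ → E3} (hw : IsLayeredCrystal c a b w) (S : Finset (Cell 2 × ℤ))
    (ϱ : ℝ) : {x : (Cell 2 × ℤ) × (Cell 2 × ℤ) | ‖bondVec a b w x‖ ≤ ϱ ∧ (x.1 ∈ S ∨ x.2 ∈ S)}.Finite := by
  have hU : ∀ p : Cell 2 × ℤ, ({x : (Cell 2 × ℤ) × (Cell 2 × ℤ) | ‖bondVec a b w x‖ ≤ ϱ ∧ x.1 = p} ∪
      {x : (Cell 2 × ℤ) × (Cell 2 × ℤ) | ‖bondVec a b w x‖ ≤ ϱ ∧ x.2 = p}).Finite := by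
    intro p
    refine Set.Finite.union ?_ ?_
    · refine ((finite_near_lsite hc hw p ϱ).image (fun Y => (p, Y))).subset ?_
      rintro x ⟨hx, rfl⟩
      exact ⟨x.2, by simpa [bondVec] using hx, rfl⟩
    · refine ((finite_near_lsite hc hw p ϱ).image (fun Y => (Y, p))).subset ?_
      rintro x ⟨hx, rfl⟩
      exact ⟨x.1, by simpa [bondVec, norm_sub_rev] using hx, rfl⟩
  refine ((S.finite_toSet.biUnion fun p _ => hU p)).subset ?_
  rintro x ⟨hx, h1 | h2⟩
  · exact Set.mem_biUnion (Finset.mem_coe.mpr h1) (Or.inl ⟨hx, rfl⟩)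
  · exact Set.mem_biUnion (Finset.mem_coe.mpr h2) (Or.inr ⟨hx, rfl⟩)

/-- FINITE REGROUPING (the finite Fubini of the scheme): route-indexed increments times non-negative pair quantities, regrouped by piece and
bounded by dominating tables. [g99] -/
theorem regroup_le {A B C : Type*} [DecidableEq C] (X : Finset A) (I : A → Finset B) (pc : A → B → C) (P : Finset C)
    (hP : ∀ x ∈ X, ∀ i ∈ I x, pc x i ∈ P) (c : A → B → ℝ) (s Θ : C → ℝ) (hs : ∀ y, 0 ≤ s y)
    (hΘ : ∀ y, (∑ x ∈ X, ∑ i ∈ I x, if pc x i = y then c x i else 0) ≤ Θ y) :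
    (∑ x ∈ X, ∑ i ∈ I x, c x i * s (pc x i)) ≤ ∑ y ∈ P, Θ y * s y := by
  have h1 : (∑ x ∈ X, ∑ i ∈ I x, c x i * s (pc x i)) =
      ∑ x ∈ X, ∑ i ∈ I x, ∑ y ∈ P, (if pc x i = y then c x i else 0) * s y := by
    refine Finset.sum_congr rfl fun x hx => Finset.sum_congr rfl fun i hi => ?_
    have : ∀ y, (if pc x i = y then c x i else 0) * s y = if pc x i = y then c x i * s y else 0 := fun y => by
      split_ifs <;> simp
    simp_rw [this]
    rw [Finset.sum_ite_eq P (pc x i) (fun y => c x i * s y), if_pos (hP x hx i hi)]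
  have h2 : (∑ x ∈ X, ∑ i ∈ I x, ∑ y ∈ P, (if pc x i = y then c x i else 0) * s y) =
      ∑ y ∈ P, (∑ x ∈ X, ∑ i ∈ I x, if pc x i = y then c x i else 0) * s y := by
    have step1 : (∑ x ∈ X, ∑ i ∈ I x, ∑ y ∈ P, (if pc x i = y then c x i else 0) * s y) =
        ∑ x ∈ X, ∑ y ∈ P, ∑ i ∈ I x, (if pc x i = y then c x i else 0) * s y :=
      Finset.sum_congr rfl fun x _ => Finset.sum_comm
    rw [step1, Finset.sum_comm]
    refine Finset.sum_congr rfl fun y _ => ?_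
    rw [Finset.sum_mul]
    refine Finset.sum_congr rfl fun x _ => ?_
    rw [Finset.sum_mul]
  rw [h1, h2]
  refine Finset.sum_le_sum fun y _ => ?_
  exact mul_le_mul_of_nonneg_right (hΘ y) (hs y)

/-! ### (TL-1)+(TL-IS): the termwise far bound -/

/-- ★ **far pair bound**: for a far pair `x` of a path system, `−schemeMajorant x ≤ pairHess x` — `pairHess_radial_lower` (the attractive radial
deficit `a₋`) followed by `indexSplit_bound` along the path (telescoping `Δφ_x = Σᵢ Δφ(pieceᵢ)`). [g99] -/
theorem far_pair_lower {ϱ α : ℝ} (hϱ : 1 ≤ ϱ) (hα : 0 < α) {a b : E3} {w : ℤ → E3}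
    {np : (Cell 2 × ℤ) × (Cell 2 × ℤ) → ℕ} {z : (Cell 2 × ℤ) × (Cell 2 × ℤ) → ℕ → Cell 2 × ℤ}
    (hP : IsPathSystem ϱ a b w np z) (φ : Cell 2 → ℤ → E3) (x : (Cell 2 × ℤ) × (Cell 2 × ℤ)) (hx : ϱ < ‖bondVec a b w x‖) :
    -schemeMajorant α a b w np z φ x ≤ pairHess a b w φ x := by
  obtain ⟨hz0, hzn, hpc⟩ := hP x hx
  set e := bondVec a b w x with he_def
  have he1 : 1 ≤ ‖e‖ := hϱ.trans hx.le
  have he0 : e ≠ 0 := by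
    intro h; rw [h, norm_zero] at he1; exact absurd he1 (by norm_num)
  have hne : x.2 ≠ x.1 := by
    intro h
    apply he0
    rw [he_def, bondVec, h, sub_self]
  rw [pairHess_eq_forceConst a b w φ x hne]
  refine le_trans ?_ (pairHess_radial_lower a b w φ x he1)
  rw [neg_le_neg_iff]
  set n := np x with hn_def
  set u : E3 := ‖e‖⁻¹ • e with hu_def
  have hu : ‖u‖ = 1 := norm_smul_inv_norm he0
  set p : Fin n → E3 := fun i => bondVec a b w (piece z x i) with hp_def
  set Δ : Fin n → E3 := fun i => φ (z x (i + 1)).1 (z x (i + 1)).2 - φ (z x i).1 (z x i).2 with hΔ_def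
  have hp : ∀ i, p i ≠ 0 := fun i => by
    have := (hpc i i.2).1
    exact norm_pos_iff.mp this
  have hA : 0 ≤ aMinus ‖e‖ := aMinus_nonneg _
  have key := indexSplit_bound u hu p Δ hp hα hA
  have hsum : ∑ i, Δ i = φ x.2.1 x.2.2 - φ x.1.1 x.1.2 := by
    have h1 : ∑ i : Fin n, Δ i = ∑ i ∈ Finset.range n, (φ (z x (i + 1)).1 (z x (i + 1)).2 - φ (z x i).1 (z x i).2) :=
      (Finset.sum_range (fun i => φ (z x (i + 1)).1 (z x (i + 1)).2 - φ (z x i).1 (z x i).2)).symm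
    rw [h1, telescope_pieces φ (z x) n, hzn, hz0]
  have hlhs : aMinus ‖e‖ * sqStretch a b w φ x = aMinus ‖e‖ * ⟪u, ∑ i, Δ i⟫ ^ 2 := by
    rw [hsum, hu_def, inner_unit_sq e _ he0]
    rfl
  rw [hlhs]
  refine key.trans (le_of_eq ?_)
  unfold schemeMajorant
  rw [Finset.sum_add_distrib, Finset.sum_range (fun i => schemeCoefR α a b w np z x i * sqStretch a b w φ (piece z x i)),
    Finset.sum_range (fun i => schemeCoefN α a b w np z x i * ‖φ (z x (i + 1)).1 (z x (i + 1)).2 - φ (z x i).1 (z x i).2‖ ^ 2)]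
  congr 1
  · refine Finset.sum_congr rfl fun i _ => ?_
    have hcos : ⟪u, p i⟫ ^ 2 / ‖p i‖ ^ 2 = cosSq a b w z x i := by
      rw [hu_def, inner_unit_sq e _ he0, cosSq, div_div]
    rw [hcos, schemeCoefR]
    rfl
  · refine Finset.sum_congr rfl fun i _ => ?_
    have hcos : ⟪u, p i⟫ ^ 2 / ‖p i‖ ^ 2 = cosSq a b w z x i := by
      rw [hu_def, inner_unit_sq e _ he0, cosSq, div_div]
    rw [hcos, schemeCoefN]

end Summit.AtomisticToContinuum.Crystallization.Theorems.ChartedZeroExcessLayeredLatticeLiouville
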